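import Mathlib
import Summits.Ventures.DiscreteObjects.Mahler.TaylorJetProduct

/-!
# Smyth's theorem, isolation of `θ₀` — the jet identity (12.29) (venture `DiscreteObjects`, target L)

Cell `pub-namedobj`, seat `pub-namedobj-mahler` (gen 8). Framing: lottery ticket; floor = certified
bounds/negative ranges.

Third piece of the isolation part of [McKee–Smyth, Thm 12.1] (blueprint `SMYTH-ISOLATION-PLAN.md` §(ii)):
the "first differing coefficient" identity behind (12.29), in a division-free form.  If two functions
`Γ, W`, holomorphic on a ball, and two complex polynomials `A, D` with `A(0) = 1` and `X^p ∣ D` satisfy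
`Γ·A = W·(A + D)` on the ball, then the Taylor coefficients agree below `p` and
`γ_p - w_p = w_0 · D_p`:

* `jetCoeff_eval_poly` — the jets of a polynomial are its coefficients;
* `jetCoeff_mul_poly` — `jet_i(F · A) = Σ_{j ≤ i} jet_j(F) · A_{i-j}`;
* `jetCoeff_eq_below_and_at` — the identity above.

In the isolation proof `Γ = f·Q₀(aX^k)`, `W = g·P₀(aX^k)`, `A = P*·P₀(aX^k)`, `D = εP·Q₀(aX^k) - A` (an
integer polynomial with `X^{2k+1} ∣ D`, see `SmythIsolationInteger`), so `|γ_p - w_p| = c·|D_p| ≥ c` at the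
first index `p` where `D_p ≠ 0`.
-/

namespace Summit.Ventures.DiscreteObjects.Mahler

open Polynomial Metric Finset

/-- The Taylor coefficients of a polynomial (as a function) are its coefficients. -/
theorem jetCoeff_eval_poly (A : ℂ[X]) (n : ℕ) : jetCoeff (fun z => A.eval z) n = A.coeff n := by
  have h : ∀ z ∈ ball (0 : ℂ) 1, (fun z => A.eval z) z =
      (∑ m ∈ range (n + 1), A.coeff m * z ^ m) + z ^ (n + 1) * (A /ₘ X ^ (n + 1)).eval z :=
    fun z _ => eval_eq_sum_range_add_pow_mul A (n + 1) z
  exact jetCoeff_unique' one_pos A.differentiable.differentiableOn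
    (Polynomial.continuous _).continuousAt h n (Nat.lt_succ_self n)

/-- **Jets of `F · A` for a polynomial `A`.** -/
theorem jetCoeff_mul_poly {r : ℝ} (hr : 0 < r) {F : ℂ → ℂ} (hF : DifferentiableOn ℂ F (ball 0 r))
    (A : ℂ[X]) (i : ℕ) :
    jetCoeff (fun z => F z * A.eval z) i = ∑ j ∈ range (i + 1), jetCoeff F j * A.coeff (i - j) := by
  rw [jetCoeff_mul hr hF A.differentiable.differentiableOn, Nat.sum_antidiagonal_eq_sum_range_succ_mk]
  refine Finset.sum_congr rfl fun j _ => ?_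
  -- jets of the polynomial do not depend on the ball radius
  have : jetCoeff (fun z => A.eval z) (i - j) = A.coeff (i - j) := jetCoeff_eval_poly A (i - j)
  rw [this]

/-- **(12.29), division-free.**  If `Γ·A = W·(A + D)` on a ball, `A(0) = 1` and `D_j = 0` for `j < p`,
then `jet_i Γ = jet_i W` for `i < p` and `jet_p Γ - jet_p W = (jet_0 W) · D_p`. -/
theorem jetCoeff_eq_below_and_at {r : ℝ} (hr : 0 < r) {Γ W : ℂ → ℂ} (hΓ : DifferentiableOn ℂ Γ (ball 0 r))
    (hW : DifferentiableOn ℂ W (ball 0 r)) (A D : ℂ[X]) (hA0 : A.coeff 0 = 1) {p : ℕ}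
    (hD : ∀ j < p, D.coeff j = 0)
    (hid : ∀ z ∈ ball (0 : ℂ) r, Γ z * A.eval z = W z * (A.eval z + D.eval z)) :
    (∀ i < p, jetCoeff Γ i = jetCoeff W i) ∧
      jetCoeff Γ p - jetCoeff W p = jetCoeff W 0 * D.coeff p := by
  -- `H := Γ - W` satisfies `H·A = W·D`
  set H : ℂ → ℂ := fun z => Γ z - W z with hH
  have hHd : DifferentiableOn ℂ H (ball 0 r) := hΓ.sub hW
  have hHAd : DifferentiableOn ℂ (fun z => H z * A.eval z) (ball 0 r) :=
    hHd.mul A.differentiable.differentiableOn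
  have hHA : ∀ z ∈ ball (0 : ℂ) r, (fun z => W z * D.eval z) z = (fun z => H z * A.eval z) z := by
    intro z hz
    simp only [hH]
    have := hid z hz
    linear_combination -this
  have hjets : ∀ i, ∑ j ∈ range (i + 1), jetCoeff H j * A.coeff (i - j) =
      ∑ j ∈ range (i + 1), jetCoeff W j * D.coeff (i - j) := by
    intro i
    rw [← jetCoeff_mul_poly hr hHd A i, ← jetCoeff_mul_poly hr hW D i]
    exact (jetCoeff_congr hr hHAd hHA i).symm
  have hHjet : ∀ i, jetCoeff H i = jetCoeff Γ i - jetCoeff W i := fun i => jetCoeff_sub hr hΓ hW i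
  -- strong induction: `jet_i H = 0` for `i < p`
  have hzero : ∀ i < p, jetCoeff H i = 0 := by
    intro i
    induction i using Nat.strong_induction_on with
    | _ i ih =>
      intro hi
      have h := hjets i
      -- right side vanishes: all `D_{i-j} = 0`
      have hR : ∑ j ∈ range (i + 1), jetCoeff W j * D.coeff (i - j) = 0 := by
        apply Finset.sum_eq_zero
        intro j hj
        rw [hD (i - j) (by omega), mul_zero]
      -- left side: only `j = i` survives
      rw [hR, Finset.sum_range_succ, Nat.sub_self, hA0, mul_one] at h
      have hL : ∑ j ∈ range i, jetCoeff H j * A.coeff (i - j) = 0 := by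
        apply Finset.sum_eq_zero
        intro j hj
        rw [Finset.mem_range] at hj
        rw [ih j hj (by omega), zero_mul]
      rw [hL, zero_add] at h
      exact h
  refine ⟨fun i hi => ?_, ?_⟩
  · have := hzero i hi
    rw [hHjet] at this
    exact sub_eq_zero.mp this
  · have h := hjets p
    rw [Finset.sum_range_succ, Nat.sub_self, hA0, mul_one] at h
    have hL : ∑ j ∈ range p, jetCoeff H j * A.coeff (p - j) = 0 := by
      apply Finset.sum_eq_zero
      intro j hj
      rw [Finset.mem_range] at hj
      rw [hzero j hj, zero_mul]
    have hR : ∑ j ∈ range (p + 1), jetCoeff W j * D.coeff (p - j) = jetCoeff W 0 * D.coeff p := by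
      rw [Finset.sum_eq_single_of_mem 0 (Finset.mem_range.mpr (Nat.succ_pos p))]
      · rw [Nat.sub_zero]
      · intro j hj hne
        rw [Finset.mem_range] at hj
        rw [hD (p - j) (by omega), mul_zero]
    rw [hL, zero_add, hR, hHjet] at h
    exact h

end Summit.Ventures.DiscreteObjects.Mahler
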